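import Summits.Ventures.CertifiedManyBodySolver.Observables.RungLeavesCoverageNdNiO2ResidualDensityW1
import Summits.Ventures.CertifiedManyBodySolver.Observables.RungLeavesCoverageNdNiO2Cut
import Summits.Ventures.CertifiedManyBodySolver.Observables.StiffnessApexTransportTargetSlotHighSlab
import Summits.Ventures.CertifiedManyBodySolver.Downfold.BoxesLa214V115M2cBoxRead
import HarnessLib

/-!
# Ventures/CertifiedManyBodySolver — Observables/RungLeavesCoverageNdNiO2ResidualDensityBundles.lean

HONEST FRAMING: one-sided certified CEILINGS on the uniform flux stiffness on the DOWNFOLDED d⁹-nickelate box of record `boxNdNiO2E_M21` (NdNiO₂ parent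
film; router/BOXES/NdNiO2.md «1BH+3BE», SCREENING-GRADE) — wording class (xx1): CONTROL / CALIBRATION + labelled heuristic; a ceiling never speaks to the
presence of superconductivity; never «certified true negative / positive»; not a `T_c` or phase-diagram statement; no summit statement is proved here.
Prop-level READERS and CONDITIONAL closers only: every bound-valued conclusion is conditional BY NAME on the bundle rows, caps and nodes it names; the
FLOOR side is discharged inside (kernel theorems, no certificate); no number of record is asserted; no `sorry`; no definition; zero compute.

Cells `pub/hubbard-obs` ∧ `pub/hubbard-downfold` (MO-S2 ∧ MO-S1, D-0154 (1)(C) COVERAGE material (iii) NdNiO₂), seat `hubbard-cov-ndnio2-unc-3`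
(`prover-hubbard-cov-ndnio2-unc-3-g2-0`; lane «filling / doping-column ladder» = the DENSITY direction, lead RULING R-ma; write_cruxes stmt-Ventures-26751
`ResidualLowUSlab` / stmt-Ventures-26752 `ResidualHighUSlab` of route-Ventures-CovNdNiO2M21 — SUPPORT, no claim). Sequel of this seat's
`Observables/RungLeavesCoverageNdNiO2ResidualDensity{,W1}.lean` (ONE window-N row at ONE source `s` read down the density interval). THE POINT. The registered
stubs `stub_lowP/Q` (box-2 birth c3dd2e4054a56a9b) and `stub_highP/Q` (52a03cb7fe55a0c4) ask for a family `v x s` at EVERY density `x ∈ R‴ = [183/200, 477/500]`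
AND EVERY source `s` of a station segment (`[−184/325, −11/25]` resp. `[−276/425, −176/325]` at `U_A = 5`); finitely many point rows do not discharge `∀ s`
(hubbard-cov-ndnio2-ref-1 flag f2′, box-1 HANDOFF item 4: «interval-valid rows = boxdual bundles over `s`-segments between the vertices»). The TEMPLATE material typed the
object a two-vertex bundle read with its density multipliers delivers: cov-la214-box-2's `TPrimeBundleOrbitLowerRowWN U s₁ s₂ lo hi F sl₁ sl₂ n₀ X`
(`Downfold/BoxesLa214V115M2cBoxRead.lean`: for every `s ∈ [s₁, s₂]` and density `x`, GIVEN `lo ≤ e₀(1,s,U,x) ≤ hi`, the value `wnBundleValue F sl₁ sl₂ n₀ x =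
F + min(sl₁, sl₂)·(x − n₀)`). This file is the NdNiO₂ (x, s)-RECTANGLE reader of that shape and the conditional closers in the cruxes' own currency:

* §1 (generic station `U_A ≥ 0`) `orbitLowerOn_subrect_of_bundleRowWN` — a bundle row + its window on a SUB-rectangle `[a, b] × [x₁, x₂]` ⇒ the family there;
  `bandBottomFloor_on_rect` + `orbitLowerOn_subrect_of_bundleRowWN_bandBottom` — the FLOOR side node-free (`min(4a, −4(1+b))·x₂ ≤ e₀` on the rectangle, this
  seat's band-bottom floor p624557/p625116), so only the CAP table stays a hypothesis;
* §2 the NdNiO₂ station literals: rectangle floors on the three W1 segments A `[−276/425, −11/20]` / B `[−11/20, −23/50]` / C `[−23/50, −11/25]` × R‴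
  (`−131652/53125`, `−5247/2500`, `−6678/3125` = this seat's anchor floor rows `ndBoxE_floorRow_tpm276o425/_tpm11o20/_tpm11o25_n477o500`), the cap side BY NAME
  (hubbard-fast-bands-1 `ndM21res_capW1_segA/B/C`, CONDITIONAL on #396 `cert_r396_luc_tl_upper_n1_U5` and the VARBOX-LITE ⅞-plane hypothesis `hVLc`);
* §3 prices: `neg_wnBundleValue_le_on_R3_of_ends` (three rational inequalities per row: both slopes at `x = 183/200`, and `−F ≤ c` at the anchor) and the σ-CHORD
  of two priced END objectives (`neg_slotChord_le_of_neg_le`);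
* §4 the CONDITIONAL CLOSERS: `ndM21_residualLowUSlab_of_bundleRowsWN` — six bundle rows (objectives `−X₀(−23/50, 5)`, `−X₀(−11/25, 5)` × segments A (used on
  `[−184/325, −11/20]`), B, C), windows as ∀-hypotheses on the used rectangles, 18 end prices `≤ c ≤ 4779578/10⁷` ⇒ LITERALLY the statement of `ResidualLowUSlab`
  (composition = box-2's birth: `le_total n (183/200)`, the strip below by `ndnio2_M21_lowFillingCell183_below_bar`, the rest by unc-2's
  `ObsStiffnessSeqCeilingAt_on_box_of_apexStation_twoEndObjectives` with `(U_A, U_max) = (5, 13/2)`). The HIGH slab (four rows: A, and B used on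
  `[−11/20, −176/325]`), the one-station edition E-R′ of BOTH slabs, and the W1-plugged forms (caps BY NAME, floors node-free: only rows + prices left) are in the
  companion `Observables/RungLeavesCoverageNdNiO2ResidualDensityBundlesHigh.lean` (400-line rule).

NOT said: that any bundle certificate exists (none does at this hour for NdNiO₂; V4/V3′ vertex legs j304682/…/j304689 in flight); a number of record; a transport
in `s` other than what a bundle row states; anything toward smaller `U`.

References: S. Boyd, L. Vandenberghe, *Convex Optimization* (2004) §5.9 [BoydVandenberghe2004]; T. Koma, H. Tasaki, J. Stat. Phys. 76 (1994) 745, §1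
[KomaTasaki1994]; D. J. Scalapino, S. R. White, S.-C. Zhang, PRB 47 (1993) 7995, §II [ScalapinoWhiteZhang1993]; E. H. Lieb, M. Loss, Duke Math. J. 71 (1993)
337, §8 Thm 8.2 [LiebLoss1993]; R. B. Israel, *Convexity in the Theory of Lattice Gases* (1979) Thm. I.3.4 [Israel1979].
-/

noncomputable section

namespace Summit.Ventures.CertifiedManyBodySolver.Observables

open Set Filter Topology
open Summit.Ventures.CertifiedManyBodySolver.Downfold
open Summit.Ventures.CertifiedManyBodySolver.Certificates
open Literature.MathematicalPhysics.QuantumLattice Literature.MathematicalPhysics.QuantumLattice.ThermodynamicLimit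
open Literature.Probability.LatticeModels
open Matrix HubbardWave0
open scoped BigOperators ComplexOrder

/-! ## §1 Rectangle readers (generic station `U_A ≥ 0`) -/

section Readers

variable {UA : ℝ}

/-- **A bundle row on a SUB-rectangle.** `TPrimeBundleOrbitLowerRowWN U_A s₁ s₂ lo hi F sl₁ sl₂ n₀ X` + its window `lo ≤ e₀(1, s, U_A, x) ≤ hi` on
`[a, b] × [x₁, x₂] ⊆ [s₁, s₂] × [0, 2)` ⇒ `wnBundleValue F sl₁ sl₂ n₀ x ≤ |D₄|⁻¹ Σ_γ Re ω_γ(Γ_γ (X s))` on the torus-limit ground-state class at every `(s, U_A, x)`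
of the sub-rectangle. [cite: BoydVandenberghe2004, §5.9] [cite: KomaTasaki1994, §1] -/
theorem orbitLowerOn_subrect_of_bundleRowWN {s₁ s₂ a b x₁ x₂ : ℝ} {lo hi F sl₁ sl₂ n₀ : ℚ}
    {X : ℝ → FermionOp (Literature.Probability.LatticeModels.box 2 7)}
    (h : TPrimeBundleOrbitLowerRowWN UA s₁ s₂ lo hi F sl₁ sl₂ n₀ X) (ha : s₁ ≤ a) (hb : b ≤ s₂) (hx₁ : 0 ≤ x₁) (hx₂ : x₂ < 2)
    (hwin : ∀ s ∈ Set.Icc a b, ∀ x ∈ Set.Icc x₁ x₂,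
      ((lo : ℚ) : ℝ) ≤ energyDensityTT' 1 s UA x ∧ energyDensityTT' 1 s UA x ≤ ((hi : ℚ) : ℝ)) :
    ∀ x ∈ Set.Icc x₁ x₂, ∀ s ∈ Set.Icc a b,
      ∀ (ω : InfVolFermionState 2) (Ls : ℕ → ℕ) (ψ : ∀ L, Fock (Orb (FermionTorus 2 L))),
      Tendsto Ls atTop atTop →
      (∀ j, IsGroundStateInSector (hubbardTorusTT' (Ls j) 1 s UA) (rectN x (Ls j)) 0 (ψ (Ls j))) →
      (∀ j, star (ψ (Ls j)) ⬝ᵥ ψ (Ls j) = 1) → ω.IsTorusLimitOf ψ Ls →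
      wnBundleValue F sl₁ sl₂ n₀ x ≤ ((Finset.univ : Finset (DihedralGroup 4)).card : ℝ)⁻¹ *
        ∑ g ∈ (Finset.univ : Finset (DihedralGroup 4)),
          (ω.expect (d4ShiftSet g 0 (Literature.Probability.LatticeModels.box 2 7))
            (fermionEmbed (PolySite.d4Emb g 0 (Literature.Probability.LatticeModels.box 2 7)) (X s))).re := by
  intro x hx s hs ω Ls ψ hLs hψ h1 hω
  obtain ⟨hlo, hhi⟩ := hwin s hs x hx
  exact h s ⟨ha.trans hs.1, hs.2.trans hb⟩ x (hx₁.trans hx.1) (lt_of_le_of_lt hx.2 hx₂) ω Ls ψ hLs hψ h1 hω hlo hhi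

/-- **The band-bottom floor on a rectangle** (node-free, any `U_A ≥ 0`): for `s ∈ [s₁, s₂]`, `x ∈ [x₁, x₂]`, `0 ≤ x₁`, `x₂ < 2`:
`min(4s₁, −4(1+s₂))·x₂ ≤ e₀(1, s, U_A, x)` (this seat's `ndBoxE_bandBottomFloor_of`: `min(4s, −4(1+s))·x ≤ e₀`; the constant is monotone in `s₁`, `s₂` and,
being `≤ −2 < 0`, smallest at `x = x₂`). [cite: LiebLoss1993, §8, Theorem 8.2] -/
theorem bandBottomFloor_on_rect {s₁ s₂ x₁ x₂ : ℝ} (hUA : 0 ≤ UA) (hx₁ : 0 ≤ x₁) (hx₂ : x₂ < 2) :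
    ∀ s ∈ Set.Icc s₁ s₂, ∀ x ∈ Set.Icc x₁ x₂, min (4 * s₁) (-(4 * (1 + s₂))) * x₂ ≤ energyDensityTT' 1 s UA x := by
  intro s hs x hx
  have hx0 : 0 ≤ x := hx₁.trans hx.1
  have hxlt : x < 2 := lt_of_le_of_lt hx.2 hx₂
  have hm : min (4 * s₁) (-(4 * (1 + s₂))) ≤ min (4 * s) (-(4 * (1 + s))) :=
    min_le_min (by linarith [hs.1]) (by linarith [hs.2])
  have h2 : min (4 * s) (-(4 * (1 + s))) ≤ -2 := by
    rcases le_total s (-1 / 2) with h | h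
    · exact (min_le_left _ _).trans (by linarith)
    · exact (min_le_right _ _).trans (by linarith)
  have hneg : min (4 * s₁) (-(4 * (1 + s₂))) ≤ 0 := hm.trans (h2.trans (by norm_num))
  calc min (4 * s₁) (-(4 * (1 + s₂))) * x₂ ≤ min (4 * s₁) (-(4 * (1 + s₂))) * x :=
        mul_le_mul_of_nonpos_left hx.2 hneg
    _ ≤ min (4 * s) (-(4 * (1 + s))) * x := mul_le_mul_of_nonneg_right hm hx0
    _ ≤ energyDensityTT' 1 s UA x := ndBoxE_bandBottomFloor_of s hUA hx0 hxlt

/-- **Bundle row ⇒ family on a sub-rectangle, FLOOR SIDE DISCHARGED**: if the row's floor literal is at or below band bottom on the rectangle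
(`lo ≤ min(4a, −4(1+b))·x₂` — the producers' idle floor rows keyed at a vertex's band-bottom literal satisfy it), only the CAP table
`e₀(1, s, U_A, x) ≤ hi` on `[a, b] × [x₁, x₂]` remains a hypothesis. [cite: BoydVandenberghe2004, §5.9] [cite: LiebLoss1993, §8, Theorem 8.2] -/
theorem orbitLowerOn_subrect_of_bundleRowWN_bandBottom (hUA : 0 ≤ UA) {s₁ s₂ a b x₁ x₂ : ℝ} {lo hi F sl₁ sl₂ n₀ : ℚ}
    {X : ℝ → FermionOp (Literature.Probability.LatticeModels.box 2 7)}
    (h : TPrimeBundleOrbitLowerRowWN UA s₁ s₂ lo hi F sl₁ sl₂ n₀ X) (ha : s₁ ≤ a) (hb : b ≤ s₂) (hx₁ : 0 ≤ x₁) (hx₂ : x₂ < 2)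
    (hlo : ((lo : ℚ) : ℝ) ≤ min (4 * a) (-(4 * (1 + b))) * x₂)
    (hcap : ∀ s ∈ Set.Icc a b, ∀ x ∈ Set.Icc x₁ x₂, energyDensityTT' 1 s UA x ≤ ((hi : ℚ) : ℝ)) :
    ∀ x ∈ Set.Icc x₁ x₂, ∀ s ∈ Set.Icc a b,
      ∀ (ω : InfVolFermionState 2) (Ls : ℕ → ℕ) (ψ : ∀ L, Fock (Orb (FermionTorus 2 L))),
      Tendsto Ls atTop atTop →
      (∀ j, IsGroundStateInSector (hubbardTorusTT' (Ls j) 1 s UA) (rectN x (Ls j)) 0 (ψ (Ls j))) →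
      (∀ j, star (ψ (Ls j)) ⬝ᵥ ψ (Ls j) = 1) → ω.IsTorusLimitOf ψ Ls →
      wnBundleValue F sl₁ sl₂ n₀ x ≤ ((Finset.univ : Finset (DihedralGroup 4)).card : ℝ)⁻¹ *
        ∑ g ∈ (Finset.univ : Finset (DihedralGroup 4)),
          (ω.expect (d4ShiftSet g 0 (Literature.Probability.LatticeModels.box 2 7))
            (fermionEmbed (PolySite.d4Emb g 0 (Literature.Probability.LatticeModels.box 2 7)) (X s))).re :=
  orbitLowerOn_subrect_of_bundleRowWN h ha hb hx₁ hx₂ fun s hs x hx =>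
    ⟨hlo.trans (bandBottomFloor_on_rect hUA hx₁ hx₂ s hs x hx), hcap s hs x hx⟩

end Readers

/-! ## §2 NdNiO₂ station `U_A = 5`, anchor `477/500`, R‴ = `[183/200, 477/500]`: rectangle floors and caps on the three W1 segments -/

section Station5Windows

/-- **Rectangle FLOORS on the three W1 segments × R‴, node-free, every `U ≥ 0`**: A `[−276/425, −11/20]`: `−131652/53125 ≤ e₀`; B `[−11/20, −23/50]`:
`−5247/2500 ≤ e₀`; C `[−23/50, −11/25]`: `−6678/3125 ≤ e₀` (= `4·(−276/425)·477/500`, `4·(−11/20)·477/500`, `−4(1 − 11/25)·477/500`: the anchor floor rows of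
`Certificates/HubbardSquare_NdBoxE_station5_apriori_floors` read on the whole rectangle). [cite: LiebLoss1993, §8, Theorem 8.2] -/
theorem ndM21_station5_rectFloors {U : ℝ} (hU : 0 ≤ U) :
    (∀ s ∈ Set.Icc (-(276 / 425) : ℝ) (-11 / 20), ∀ x ∈ Set.Icc (183 / 200 : ℝ) (477 / 500),
        (((-131652 / 53125 : ℚ)) : ℝ) ≤ energyDensityTT' 1 s U x) ∧
      (∀ s ∈ Set.Icc (-11 / 20 : ℝ) (-23 / 50), ∀ x ∈ Set.Icc (183 / 200 : ℝ) (477 / 500),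
        (((-5247 / 2500 : ℚ)) : ℝ) ≤ energyDensityTT' 1 s U x) ∧
      (∀ s ∈ Set.Icc (-23 / 50 : ℝ) (-11 / 25), ∀ x ∈ Set.Icc (183 / 200 : ℝ) (477 / 500),
        (((-6678 / 3125 : ℚ)) : ℝ) ≤ energyDensityTT' 1 s U x) := by
  refine ⟨fun s hs x hx => le_trans ?_ (bandBottomFloor_on_rect hU (by norm_num) (by norm_num) s hs x hx),
    fun s hs x hx => le_trans ?_ (bandBottomFloor_on_rect hU (by norm_num) (by norm_num) s hs x hx),
    fun s hs x hx => le_trans ?_ (bandBottomFloor_on_rect hU (by norm_num) (by norm_num) s hs x hx)⟩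
  · rw [min_eq_left (by norm_num)]; norm_num
  · rw [min_eq_left (by norm_num)]; norm_num
  · rw [min_eq_right (by norm_num)]; norm_num

/-- **Rectangle CAPS on the three W1 segments × R‴ at the station `U = 5`, BY NAME** (hubbard-fast-bands-1 `ndM21res_capW1_segA/B/C`, valid `0 ≤ U ≤ 5`,
`n ∈ [7/8, 477/500] ⊇ R‴`; CONDITIONAL on #396 and the VARBOX-LITE ⅞-plane hypothesis `hVLc`): A `e₀ ≤ −0.7587708950`, B `e₀ ≤ −0.7557173026`,
C `e₀ ≤ −0.7550387265`. [cite: BachLiebSolovej1994, eq. (2c.36)] [cite: Ruelle1969, §3.3] -/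
theorem ndM21_station5_rectCapsW1 (h396 : cert_r396_luc_tl_upper_n1_U5)
    (hVLc : ∀ (t' U : ℝ), 0 ≤ U → energyDensityTT' 1 t' U (7/8) ≤
      (((-7377272037223195422429862170529815372887/6805647338418769269267492148635364229120 : ℚ)) : ℝ) + max (t' * (((627465977283229597904870754625335737641/6805647338418769269267492148635364229120 : ℚ)) : ℝ))
        (t' * (((125493195456645919580974150925150894595/1361129467683753853853498429727072845824 : ℚ)) : ℝ)) + U * (((416129997550995582202813714388041933571/6805647338418769269267492148635364229120 : ℚ)) : ℝ)) :
    (∀ s ∈ Set.Icc (-(276 / 425) : ℝ) (-11 / 20), ∀ x ∈ Set.Icc (183 / 200 : ℝ) (477 / 500),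
        energyDensityTT' 1 s 5 x ≤ (((-7587708950 / 10000000000 : ℚ)) : ℝ)) ∧
      (∀ s ∈ Set.Icc (-11 / 20 : ℝ) (-23 / 50), ∀ x ∈ Set.Icc (183 / 200 : ℝ) (477 / 500),
        energyDensityTT' 1 s 5 x ≤ (((-7557173026 / 10000000000 : ℚ)) : ℝ)) ∧
      (∀ s ∈ Set.Icc (-23 / 50 : ℝ) (-11 / 25), ∀ x ∈ Set.Icc (183 / 200 : ℝ) (477 / 500),
        energyDensityTT' 1 s 5 x ≤ (((-7550387265 / 10000000000 : ℚ)) : ℝ)) := by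
  refine ⟨fun s hs x hx => ?_, fun s hs x hx => ?_, fun s hs x hx => ?_⟩
  · have h := ndM21res_capW1_segA h396 hVLc 5 s x (by norm_num) le_rfl (by linarith [hs.1]) hs.2 (by linarith [hx.1]) hx.2
    exact h.trans (le_of_eq (by norm_num))
  · have h := ndM21res_capW1_segB h396 hVLc 5 s x (by norm_num) le_rfl hs.1 hs.2 (by linarith [hx.1]) hx.2
    exact h.trans (le_of_eq (by norm_num))
  · have h := ndM21res_capW1_segC h396 hVLc 5 s x (by norm_num) le_rfl hs.1 hs.2 (by linarith [hx.1]) hx.2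
    exact h.trans (le_of_eq (by norm_num))

end Station5Windows

/-! ## §3 Prices: a bundle row's value on R‴ from three rational inequalities; the σ-chord of two priced END objectives -/

/-- **PRICE OF ONE ROW ON R‴** (anchor `n₀ = 477/500` = the TOP of R‴, so the anchor-end inequalities collapse to `−F ≤ c`): if `−F − sl₁·(183/200 − 477/500) ≤ c`,
`−F − sl₂·(183/200 − 477/500) ≤ c` and `−F ≤ c`, then `−wnBundleValue F sl₁ sl₂ (477/500) x ≤ c` at every `x ∈ R‴`. [cite: Israel1979, Thm. I.3.4] -/
theorem neg_wnBundleValue_le_on_R3_of_ends {F sl₁ sl₂ c : ℚ}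
    (h₁ : -F - sl₁ * (183 / 200 - 477 / 500) ≤ c) (h₂ : -F - sl₂ * (183 / 200 - 477 / 500) ≤ c) (h₀ : -F ≤ c) :
    ∀ x ∈ Set.Icc (183 / 200 : ℝ) (477 / 500), -wnBundleValue F sl₁ sl₂ (477 / 500) x ≤ ((c : ℚ) : ℝ) := by
  intro x hx
  have eN : (((477 / 500 : ℚ)) : ℝ) = 477 / 500 := by norm_num
  have hx' : x ≤ (((477 / 500 : ℚ)) : ℝ) := by rw [eN]; exact hx.2
  have a₁ : -((F : ℚ) : ℝ) - ((sl₁ : ℚ) : ℝ) * ((183 / 200 : ℝ) - (((477 / 500 : ℚ)) : ℝ)) ≤ ((c : ℚ) : ℝ) := by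
    have h' : (((-F - sl₁ * (183 / 200 - 477 / 500) : ℚ)) : ℝ) ≤ ((c : ℚ) : ℝ) := Rat.cast_le.2 h₁
    rw [eN]; push_cast at h' ⊢; linarith
  have a₂ : -((F : ℚ) : ℝ) - ((sl₂ : ℚ) : ℝ) * ((183 / 200 : ℝ) - (((477 / 500 : ℚ)) : ℝ)) ≤ ((c : ℚ) : ℝ) := by
    have h' : (((-F - sl₂ * (183 / 200 - 477 / 500) : ℚ)) : ℝ) ≤ ((c : ℚ) : ℝ) := Rat.cast_le.2 h₂
    rw [eN]; push_cast at h' ⊢; linarith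
  have b₁ : -((F : ℚ) : ℝ) - ((sl₁ : ℚ) : ℝ) * ((((477 / 500 : ℚ)) : ℝ) - (((477 / 500 : ℚ)) : ℝ)) ≤ ((c : ℚ) : ℝ) := by
    rw [sub_self, mul_zero, sub_zero]; exact_mod_cast h₀
  have b₂ : -((F : ℚ) : ℝ) - ((sl₂ : ℚ) : ℝ) * ((((477 / 500 : ℚ)) : ℝ) - (((477 / 500 : ℚ)) : ℝ)) ≤ ((c : ℚ) : ℝ) := by
    rw [sub_self, mul_zero, sub_zero]; exact_mod_cast h₀
  exact neg_wnBundleValue_le_of_ends hx.1 hx' a₁ b₁ a₂ b₂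

/-- **σ-CHORD PRICE**: for `p < q`, `σ ∈ [p, q]`, if `−vP ≤ c` and `−vQ ≤ c` then `−((q − σ)/(q − p)·vP + (σ − p)/(q − p)·vQ) ≤ c` (convex weights). [folklore] -/
theorem neg_slotChord_le_of_neg_le {p q σ vP vQ c : ℝ} (hpq : p < q) (hσ : σ ∈ Set.Icc p q) (hP : -vP ≤ c) (hQ : -vQ ≤ c) :
    -((q - σ) / (q - p) * vP + (σ - p) / (q - p) * vQ) ≤ c := by
  have hd : 0 < q - p := sub_pos.2 hpq
  have hw₁ : 0 ≤ (q - σ) / (q - p) := div_nonneg (by linarith [hσ.2]) hd.le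
  have hw₂ : 0 ≤ (σ - p) / (q - p) := div_nonneg (by linarith [hσ.1]) hd.le
  have hws : (q - σ) / (q - p) + (σ - p) / (q - p) = 1 := by
    rw [← add_div]
    have : q - σ + (σ - p) = q - p := by ring
    rw [this]
    exact div_self hd.ne'
  have k₁ := mul_le_mul_of_nonneg_left hP hw₁
  have k₂ := mul_le_mul_of_nonneg_left hQ hw₂
  have : -((q - σ) / (q - p) * vP + (σ - p) / (q - p) * vQ) = (q - σ) / (q - p) * (-vP) + (σ - p) / (q - p) * (-vQ) := by ring
  rw [this]
  calc (q - σ) / (q - p) * (-vP) + (σ - p) / (q - p) * (-vQ) ≤ (q - σ) / (q - p) * c + (σ - p) / (q - p) * c := add_le_add k₁ k₂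
    _ = c := by rw [← add_mul, hws, one_mul]

/-- **PRICE OF A THREE-PIECE FAMILY** (pieces switched at `s = −11/20` and `s = −23/50`): three priced rows ⇒ the negated piecewise value `≤ c` on R‴ at every `s`.
[cite: Israel1979, Thm. I.3.4] -/
theorem neg_piecewise3_le_of_endPrices {FA sA₁ sA₂ FB sB₁ sB₂ FC sC₁ sC₂ c : ℚ}
    (pA : -FA - sA₁ * (183 / 200 - 477 / 500) ≤ c ∧ -FA - sA₂ * (183 / 200 - 477 / 500) ≤ c ∧ -FA ≤ c)
    (pB : -FB - sB₁ * (183 / 200 - 477 / 500) ≤ c ∧ -FB - sB₂ * (183 / 200 - 477 / 500) ≤ c ∧ -FB ≤ c)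
    (pC : -FC - sC₁ * (183 / 200 - 477 / 500) ≤ c ∧ -FC - sC₂ * (183 / 200 - 477 / 500) ≤ c ∧ -FC ≤ c) :
    ∀ x ∈ Set.Icc (183 / 200 : ℝ) (477 / 500), ∀ s : ℝ,
      -(if s ≤ -11 / 20 then wnBundleValue FA sA₁ sA₂ (477 / 500) x
        else if s ≤ -23 / 50 then wnBundleValue FB sB₁ sB₂ (477 / 500) x else wnBundleValue FC sC₁ sC₂ (477 / 500) x) ≤ ((c : ℚ) : ℝ) := by
  intro x hx s
  by_cases hA : s ≤ -11 / 20
  · simp only [if_pos hA]; exact neg_wnBundleValue_le_on_R3_of_ends pA.1 pA.2.1 pA.2.2 x hx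
  · by_cases hB : s ≤ -23 / 50
    · simp only [if_neg hA, if_pos hB]; exact neg_wnBundleValue_le_on_R3_of_ends pB.1 pB.2.1 pB.2.2 x hx
    · simp only [if_neg hA, if_neg hB]; exact neg_wnBundleValue_le_on_R3_of_ends pC.1 pC.2.1 pC.2.2 x hx

/-! ## §4 NdNiO₂ station `U_A = 5`: piecewise families from bundle rows and the CONDITIONAL closers of the two cruxes -/

section Station5Closers

/-- The anchor cast: `((477/500 : ℚ) : ℝ) = 477/500`. [folklore] -/
private theorem anchor_cast' : (((477 / 500 : ℚ)) : ℝ) = 477 / 500 := by norm_num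

/-- **THREE-PIECE FAMILY for one objective slot `σ`** (station `U_A = 5`, anchor `477/500`): bundle rows on segments `[sA₁, sA₂] ⊇ [a, −11/20]`, `[sB₁, sB₂] ⊇
[−11/20, −23/50]`, `[sC₁, sC₂] ⊇ [−23/50, −11/25]` for the objective `−X₀(σ, 5)`, each with its window DISCHARGED on (used segment) × R‴ (∀-hypotheses; floors: §2,
caps: §2 BY NAME) ⇒ at every `x ∈ R‴` and every `s ∈ [a, −11/25]` the value `if s ≤ −11/20 then wnBundleValue_A x else if s ≤ −23/50 then wnBundleValue_B x else
wnBundleValue_C x` is an orbit-LOWER bound on the torus-limit ground-state class at `(s, 5, x)`. [cite: BoydVandenberghe2004, §5.9] [cite: KomaTasaki1994, §1] -/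
theorem ndM21_station5_family3_of_bundleRowsWN (σ : ℝ) {a sA₁ sA₂ sB₁ sB₂ sC₁ sC₂ : ℝ}
    {loA hiA FA slA₁ slA₂ loB hiB FB slB₁ slB₂ loC hiC FC slC₁ slC₂ : ℚ}
    (hA : TPrimeBundleOrbitLowerRowWN 5 sA₁ sA₂ loA hiA FA slA₁ slA₂ (477 / 500) (fun _ => -oddMomentObsTT σ 5 0))
    (hB : TPrimeBundleOrbitLowerRowWN 5 sB₁ sB₂ loB hiB FB slB₁ slB₂ (477 / 500) (fun _ => -oddMomentObsTT σ 5 0))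
    (hC : TPrimeBundleOrbitLowerRowWN 5 sC₁ sC₂ loC hiC FC slC₁ slC₂ (477 / 500) (fun _ => -oddMomentObsTT σ 5 0))
    (haA : sA₁ ≤ a) (hA₂ : (-11 / 20 : ℝ) ≤ sA₂) (hB₁ : sB₁ ≤ -11 / 20) (hB₂ : (-23 / 50 : ℝ) ≤ sB₂)
    (hC₁ : sC₁ ≤ -23 / 50) (hC₂ : (-11 / 25 : ℝ) ≤ sC₂)
    (hwinA : ∀ s ∈ Set.Icc a (-11 / 20), ∀ x ∈ Set.Icc (183 / 200 : ℝ) (477 / 500),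
      ((loA : ℚ) : ℝ) ≤ energyDensityTT' 1 s 5 x ∧ energyDensityTT' 1 s 5 x ≤ ((hiA : ℚ) : ℝ))
    (hwinB : ∀ s ∈ Set.Icc (-11 / 20 : ℝ) (-23 / 50), ∀ x ∈ Set.Icc (183 / 200 : ℝ) (477 / 500),
      ((loB : ℚ) : ℝ) ≤ energyDensityTT' 1 s 5 x ∧ energyDensityTT' 1 s 5 x ≤ ((hiB : ℚ) : ℝ))
    (hwinC : ∀ s ∈ Set.Icc (-23 / 50 : ℝ) (-11 / 25), ∀ x ∈ Set.Icc (183 / 200 : ℝ) (477 / 500),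
      ((loC : ℚ) : ℝ) ≤ energyDensityTT' 1 s 5 x ∧ energyDensityTT' 1 s 5 x ≤ ((hiC : ℚ) : ℝ)) :
    ∀ x ∈ Set.Icc (183 / 200 : ℝ) (477 / 500), ∀ s ∈ Set.Icc a (-11 / 25),
      ∀ (ω : InfVolFermionState 2) (Ls : ℕ → ℕ) (ψ : ∀ L, Fock (Orb (FermionTorus 2 L))),
      Tendsto Ls atTop atTop →
      (∀ j, IsGroundStateInSector (hubbardTorusTT' (Ls j) 1 s 5) (rectN x (Ls j)) 0 (ψ (Ls j))) →
      (∀ j, star (ψ (Ls j)) ⬝ᵥ ψ (Ls j) = 1) → ω.IsTorusLimitOf ψ Ls →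
      (if s ≤ -11 / 20 then wnBundleValue FA slA₁ slA₂ (477 / 500) x
        else if s ≤ -23 / 50 then wnBundleValue FB slB₁ slB₂ (477 / 500) x else wnBundleValue FC slC₁ slC₂ (477 / 500) x) ≤
        ((Finset.univ : Finset (DihedralGroup 4)).card : ℝ)⁻¹ * ∑ g ∈ (Finset.univ : Finset (DihedralGroup 4)),
          (ω.expect (d4ShiftSet g 0 (Literature.Probability.LatticeModels.box 2 7))
            (fermionEmbed (PolySite.d4Emb g 0 (Literature.Probability.LatticeModels.box 2 7)) (-oddMomentObsTT σ 5 0))).re := by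
  intro x hx s hs ω Ls ψ hLs hψ h1 hω
  have fA := orbitLowerOn_subrect_of_bundleRowWN hA haA hA₂ (by norm_num : (0 : ℝ) ≤ 183 / 200) (by norm_num : (477 / 500 : ℝ) < 2) hwinA
  have fB := orbitLowerOn_subrect_of_bundleRowWN hB hB₁ hB₂ (by norm_num : (0 : ℝ) ≤ 183 / 200) (by norm_num : (477 / 500 : ℝ) < 2) hwinB
  have fC := orbitLowerOn_subrect_of_bundleRowWN hC hC₁ hC₂ (by norm_num : (0 : ℝ) ≤ 183 / 200) (by norm_num : (477 / 500 : ℝ) < 2) hwinC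
  by_cases hs1 : s ≤ -11 / 20
  · simp only [if_pos hs1]
    exact fA x hx s ⟨hs.1, hs1⟩ ω Ls ψ hLs hψ h1 hω
  · by_cases hs2 : s ≤ -23 / 50
    · simp only [if_neg hs1, if_pos hs2]
      exact fB x hx s ⟨(not_le.1 hs1).le, hs2⟩ ω Ls ψ hLs hψ h1 hω
    · simp only [if_neg hs1, if_neg hs2]
      exact fC x hx s ⟨(not_le.1 hs2).le, hs.2⟩ ω Ls ψ hLs hψ h1 hω

/-- **CONDITIONAL CLOSER OF `ResidualLowUSlab` FROM SIX BUNDLE ROWS** (station `U_A = 5`, `U_max = 13/2`, sources `[−184/325, −11/25]`). Objectives `P = −X₀(−23/50, 5)`,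
`Q = −X₀(−11/25, 5)`; segments A `[sA₁, sA₂] ⊇ [−184/325, −11/20]`, B `⊇ [−11/20, −23/50]`, C `⊇ [−23/50, −11/25]` (`P` and `Q` rows of a segment may carry different
windows); windows as ∀-hypotheses on the USED rectangles (discharge: §2); the 18 end prices `≤ c`; `c ≤ 4779578/10⁷`. Then — literally the statement of
`Theses.CovNdNiO2M21.ResidualLowUSlab` — `∀ tp ∈ [−23/50, −11/25], ∀ U ∈ [5, 13/2], ∀ n ∈ [9/10, 477/500], ObsStiffnessSeqCeilingAt tp U n (4779578/10⁷)`: the strip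
`n ≤ 183/200` by `ndnio2_M21_lowFillingCell183_below_bar` (box-2, node-free), the rest by `ObsStiffnessSeqCeilingAt_on_box_of_apexStation_twoEndObjectives` (unc-2) with
the two three-piece families and the σ-chord price. CONDITIONAL on the six rows and the windows; no number asserted.
[cite: KomaTasaki1994, §1] [cite: ScalapinoWhiteZhang1993, §II] [cite: BoydVandenberghe2004, §5.9] -/
theorem ndM21_residualLowUSlab_of_bundleRowsWN {sA₁ sA₂ sB₁ sB₂ sC₁ sC₂ : ℝ}
    {loPA hiPA FPA sPA₁ sPA₂ loQA hiQA FQA sQA₁ sQA₂ loPB hiPB FPB sPB₁ sPB₂ loQB hiQB FQB sQB₁ sQB₂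
      loPC hiPC FPC sPC₁ sPC₂ loQC hiQC FQC sQC₁ sQC₂ c : ℚ}
    (hPA : TPrimeBundleOrbitLowerRowWN 5 sA₁ sA₂ loPA hiPA FPA sPA₁ sPA₂ (477 / 500) (fun _ => -oddMomentObsTT (-23 / 50) 5 0))
    (hQA : TPrimeBundleOrbitLowerRowWN 5 sA₁ sA₂ loQA hiQA FQA sQA₁ sQA₂ (477 / 500) (fun _ => -oddMomentObsTT (-11 / 25) 5 0))
    (hPB : TPrimeBundleOrbitLowerRowWN 5 sB₁ sB₂ loPB hiPB FPB sPB₁ sPB₂ (477 / 500) (fun _ => -oddMomentObsTT (-23 / 50) 5 0))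
    (hQB : TPrimeBundleOrbitLowerRowWN 5 sB₁ sB₂ loQB hiQB FQB sQB₁ sQB₂ (477 / 500) (fun _ => -oddMomentObsTT (-11 / 25) 5 0))
    (hPC : TPrimeBundleOrbitLowerRowWN 5 sC₁ sC₂ loPC hiPC FPC sPC₁ sPC₂ (477 / 500) (fun _ => -oddMomentObsTT (-23 / 50) 5 0))
    (hQC : TPrimeBundleOrbitLowerRowWN 5 sC₁ sC₂ loQC hiQC FQC sQC₁ sQC₂ (477 / 500) (fun _ => -oddMomentObsTT (-11 / 25) 5 0))
    (hA₁ : sA₁ ≤ -(184 / 325)) (hA₂ : (-11 / 20 : ℝ) ≤ sA₂) (hB₁ : sB₁ ≤ -11 / 20) (hB₂ : (-23 / 50 : ℝ) ≤ sB₂)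
    (hC₁ : sC₁ ≤ -23 / 50) (hC₂ : (-11 / 25 : ℝ) ≤ sC₂)
    (hwinPA : ∀ s ∈ Set.Icc (-(184 / 325) : ℝ) (-11 / 20), ∀ x ∈ Set.Icc (183 / 200 : ℝ) (477 / 500),
      ((loPA : ℚ) : ℝ) ≤ energyDensityTT' 1 s 5 x ∧ energyDensityTT' 1 s 5 x ≤ ((hiPA : ℚ) : ℝ))
    (hwinQA : ∀ s ∈ Set.Icc (-(184 / 325) : ℝ) (-11 / 20), ∀ x ∈ Set.Icc (183 / 200 : ℝ) (477 / 500),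
      ((loQA : ℚ) : ℝ) ≤ energyDensityTT' 1 s 5 x ∧ energyDensityTT' 1 s 5 x ≤ ((hiQA : ℚ) : ℝ))
    (hwinPB : ∀ s ∈ Set.Icc (-11 / 20 : ℝ) (-23 / 50), ∀ x ∈ Set.Icc (183 / 200 : ℝ) (477 / 500),
      ((loPB : ℚ) : ℝ) ≤ energyDensityTT' 1 s 5 x ∧ energyDensityTT' 1 s 5 x ≤ ((hiPB : ℚ) : ℝ))
    (hwinQB : ∀ s ∈ Set.Icc (-11 / 20 : ℝ) (-23 / 50), ∀ x ∈ Set.Icc (183 / 200 : ℝ) (477 / 500),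
      ((loQB : ℚ) : ℝ) ≤ energyDensityTT' 1 s 5 x ∧ energyDensityTT' 1 s 5 x ≤ ((hiQB : ℚ) : ℝ))
    (hwinPC : ∀ s ∈ Set.Icc (-23 / 50 : ℝ) (-11 / 25), ∀ x ∈ Set.Icc (183 / 200 : ℝ) (477 / 500),
      ((loPC : ℚ) : ℝ) ≤ energyDensityTT' 1 s 5 x ∧ energyDensityTT' 1 s 5 x ≤ ((hiPC : ℚ) : ℝ))
    (hwinQC : ∀ s ∈ Set.Icc (-23 / 50 : ℝ) (-11 / 25), ∀ x ∈ Set.Icc (183 / 200 : ℝ) (477 / 500),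
      ((loQC : ℚ) : ℝ) ≤ energyDensityTT' 1 s 5 x ∧ energyDensityTT' 1 s 5 x ≤ ((hiQC : ℚ) : ℝ))
    (pPA : -FPA - sPA₁ * (183 / 200 - 477 / 500) ≤ c ∧ -FPA - sPA₂ * (183 / 200 - 477 / 500) ≤ c ∧ -FPA ≤ c)
    (pQA : -FQA - sQA₁ * (183 / 200 - 477 / 500) ≤ c ∧ -FQA - sQA₂ * (183 / 200 - 477 / 500) ≤ c ∧ -FQA ≤ c)
    (pPB : -FPB - sPB₁ * (183 / 200 - 477 / 500) ≤ c ∧ -FPB - sPB₂ * (183 / 200 - 477 / 500) ≤ c ∧ -FPB ≤ c)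
    (pQB : -FQB - sQB₁ * (183 / 200 - 477 / 500) ≤ c ∧ -FQB - sQB₂ * (183 / 200 - 477 / 500) ≤ c ∧ -FQB ≤ c)
    (pPC : -FPC - sPC₁ * (183 / 200 - 477 / 500) ≤ c ∧ -FPC - sPC₂ * (183 / 200 - 477 / 500) ≤ c ∧ -FPC ≤ c)
    (pQC : -FQC - sQC₁ * (183 / 200 - 477 / 500) ≤ c ∧ -FQC - sQC₂ * (183 / 200 - 477 / 500) ≤ c ∧ -FQC ≤ c)
    (hc : c ≤ 4779578 / 10000000) :
    ∀ tp ∈ Set.Icc (-23 / 50 : ℝ) (-11 / 25), ∀ U ∈ Set.Icc (5 : ℝ) (13 / 2), ∀ n ∈ Set.Icc (9 / 10 : ℝ) (477 / 500),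
      ObsStiffnessSeqCeilingAt tp U n (4779578 / 10000000) := by
  intro tp htp U hU n hn
  -- density split at 183/200: the strip below is node-free kinematics below the bar (box-2)
  rcases le_total n (183 / 200) with hlow | hhigh
  · exact ndnio2_M21_lowFillingCell183_below_bar (U := U) htp ⟨by linarith [hn.1], hlow⟩
  have hn' : n ∈ Set.Icc (183 / 200 : ℝ) (477 / 500) := ⟨hhigh, hn.2⟩
  have eL : (-23 / 50 : ℝ) * (2 - (5 : ℝ) / (13 / 2 : ℝ)) = -(184 / 325) := by norm_num
  -- the two three-piece families at the density `n`
  have fP := ndM21_station5_family3_of_bundleRowsWN (-23 / 50) hPA hPB hPC hA₁ hA₂ hB₁ hB₂ hC₁ hC₂ hwinPA hwinPB hwinPC n hn'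
  have fQ := ndM21_station5_family3_of_bundleRowsWN (-11 / 25) hQA hQB hQC hA₁ hA₂ hB₁ hB₂ hC₁ hC₂ hwinQA hwinQB hwinQC n hn'
  have cP := neg_piecewise3_le_of_endPrices pPA pPB pPC n hn'
  have cQ := neg_piecewise3_le_of_endPrices pQA pQB pQC n hn'
  refine (ObsStiffnessSeqCeilingAt_on_box_of_apexStation_twoEndObjectives (p := -23 / 50) (q := -11 / 25) (UA := (5 : ℝ))
    (Umax := (13 / 2 : ℝ)) (n := n) (by norm_num) (by norm_num) (by norm_num) (by linarith [hn'.1]) (by linarith [hn'.2])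
    (fun s => if s ≤ -11 / 20 then wnBundleValue FPA sPA₁ sPA₂ (477 / 500) n
      else if s ≤ -23 / 50 then wnBundleValue FPB sPB₁ sPB₂ (477 / 500) n else wnBundleValue FPC sPC₁ sPC₂ (477 / 500) n)
    (fun s => if s ≤ -11 / 20 then wnBundleValue FQA sQA₁ sQA₂ (477 / 500) n
      else if s ≤ -23 / 50 then wnBundleValue FQB sQB₁ sQB₂ (477 / 500) n else wnBundleValue FQC sQC₁ sQC₂ (477 / 500) n)
    c (fun s hs => fP s (by rw [eL] at hs; exact hs)) (fun s hs => fQ s (by rw [eL] at hs; exact hs)) ?_ tp htp U hU).mono hc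
  intro σ hσ s _
  exact neg_slotChord_le_of_neg_le (by norm_num) hσ (cP s) (cQ s)

end Station5Closers

end Summit.Ventures.CertifiedManyBodySolver.Observables

end
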